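import Mathlib
import HarnessLib
import Summits.HubbardSuperconductivity.HubbardSuperconductivity.Theorems.KLProgrammeH10TwoPointLimitLineDerivTwo
import Literature.Probability.LatticeModels.TorusMomentaInRotatedBox

/-!
# Route `KLProgramme` — engine support, route (L2) symbol layer (b₃), geometry: a `C²` level function near a zero `p_F` —
# second-order Taylor along segments, the THIN (normal) extent `O(Λ + K₂ρ²)` of the shell `{|e| ≤ Λ}` inside a cell of radius `ρ`,
# the drift of directional derivatives across the cell, and the rotated-box count of torus momenta

Cell `gate-hubbard-kl`, seat p4 (C5a lead), g6; HOME/prover-p4/FRAME-L22-NOTE.md §3″ (b₃) («the √Λ angular saving in #supp is essential»).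
Generic in a `C²` function `e` on a real normed space with `‖D²e‖ ≤ K₂` (for the engine: `e = frameLevel μ K ∘ toLp`, the frame's
band; `p_F = klFermiPoint μ K θ_ω`; `ρ` = the cell radius of `…FrameSectorCell`):

* §1 `norm_fderiv_sub_fderiv_le` (`‖De(p) − De(q)‖ ≤ K₂‖p − q‖`), `abs_fderiv_apply_sub_le`, **`abs_taylor_two_le`**
  (`|e(c) − e(p) − De(p)(c − p)| ≤ K₂‖c − p‖²`), `abs_fderiv_apply_le_of_level` (`e(p_F) = 0`, `|e(c)| ≤ Λ` ⇒
  `|De(p_F)(c − p_F)| ≤ Λ + K₂‖c − p_F‖²`: the shell is THIN across the level set), `abs_fderiv_apply_le_of_near`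
  (`|De(c)w| ≤ |De(p_F)w| + K₂‖c − p_F‖‖w‖`: a direction tangent at `p_F` stays nearly tangent on the cell);
* §2 on `Fin 2 → ℝ` (sup norm): the gradient pair `gᵢ = De(p)(eᵢ)`, `De(p)d = d₀g₀ + d₁g₁` (`fderiv_apply_eq_grad`), and for the unit
  frame `n = g/|g|`, `τ = n⊥`: **`frame_coords_of_cell`** — `‖c − p_F‖ ≤ ρ`, `|e(c)| ≤ Λ`, `e(p_F) = 0`, `|g| ≥ γ > 0` ⇒
  `|⟨c − p_F, n⟩| ≤ (Λ + K₂ρ²)/γ` and `|⟨c − p_F, τ⟩| ≤ 2ρ`;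
* §3 **`card_filter_cell_le`** — hence the torus momenta `2πk̃/L` of such a cell number at most
  `(√2 L (Λ + K₂ρ²)/(γπ) + 2)(2√2 L ρ/π + 2)` (`TorusMomentaInRotatedBox.card_filter_momenta_frameBox_le`): area `Λ × ρ`, not `ρ × ρ`.

Everything is proved; no definitions, no named facts. [folklore]  (Benfatto–Giuliani–Mastropietro 2006 §2.5 (2.46)–(2.50): an anisotropic
sector has `O(βL²γ^{h}γ^{h/2})` modes.)
-/

noncomputable section

namespace Summit.HubbardSuperconductivity.HubbardSuperconductivity.Theorems.TorusFourierL2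

set_option linter.dupNamespace false -- summit = problem name (single-conjunct summit), D-0017

open Set Finset Literature.Probability.LatticeModels
open scoped Real

/-! ### §1 Second-order calculus of a `C²` function on a normed space -/

section Normed

variable {V : Type*} [NormedAddCommGroup V] [NormedSpace ℝ V]

/-- **The derivative is `K₂`-Lipschitz**: `‖De(p) − De(q)‖ ≤ K₂‖p − q‖` when `‖D²e‖ ≤ K₂`. [folklore] -/
theorem norm_fderiv_sub_fderiv_le {e : V → ℝ} (he : ContDiff ℝ 2 e) {K₂ : ℝ} (hK₂ : ∀ p, ‖iteratedFDeriv ℝ 2 e p‖ ≤ K₂)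
    (p q : V) : ‖fderiv ℝ e p - fderiv ℝ e q‖ ≤ K₂ * ‖p - q‖ := by
  have h1 : ContDiff ℝ 1 (fderiv ℝ e) := he.fderiv_right (m := 1) (by norm_num)
  have hd : ∀ x ∈ (Set.univ : Set V), DifferentiableAt ℝ (fderiv ℝ e) x := fun x _ =>
    h1.differentiable (by norm_num) x
  have hb : ∀ x ∈ (Set.univ : Set V), ‖fderiv ℝ (fderiv ℝ e) x‖ ≤ K₂ := fun x _ => by
    have h := hK₂ x
    rw [← norm_iteratedFDeriv_fderiv, norm_iteratedFDeriv_one] at h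
    exact h
  exact Convex.norm_image_sub_le_of_norm_fderiv_le hd hb convex_univ (Set.mem_univ q) (Set.mem_univ p)

/-- `|De(p)w − De(q)w| ≤ K₂‖p − q‖‖w‖`. [folklore] -/
theorem abs_fderiv_apply_sub_le {e : V → ℝ} (he : ContDiff ℝ 2 e) {K₂ : ℝ} (hK₂ : ∀ p, ‖iteratedFDeriv ℝ 2 e p‖ ≤ K₂)
    (p q w : V) : |fderiv ℝ e p w - fderiv ℝ e q w| ≤ K₂ * ‖p - q‖ * ‖w‖ := by
  have h := norm_fderiv_sub_fderiv_le he hK₂ p q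
  have h1 : fderiv ℝ e p w - fderiv ℝ e q w = (fderiv ℝ e p - fderiv ℝ e q) w := by simp
  rw [h1, ← Real.norm_eq_abs]
  exact ((fderiv ℝ e p - fderiv ℝ e q).le_opNorm w).trans (mul_le_mul_of_nonneg_right h (norm_nonneg _))

/-- **A direction stays nearly tangent across a cell**: `|De(c)w| ≤ |De(p_F)w| + K₂‖c − p_F‖‖w‖`. [folklore] -/
theorem abs_fderiv_apply_le_of_near {e : V → ℝ} (he : ContDiff ℝ 2 e) {K₂ : ℝ} (hK₂ : ∀ p, ‖iteratedFDeriv ℝ 2 e p‖ ≤ K₂)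
    (pF c w : V) : |fderiv ℝ e c w| ≤ |fderiv ℝ e pF w| + K₂ * ‖c - pF‖ * ‖w‖ := by
  have h := abs_fderiv_apply_sub_le he hK₂ c pF w
  have := abs_sub_abs_le_abs_sub (fderiv ℝ e c w) (fderiv ℝ e pF w)
  linarith

/-- **Second-order Taylor along a segment**: `|e(c) − e(p) − De(p)(c − p)| ≤ K₂‖c − p‖²`. [folklore] -/
theorem abs_taylor_two_le {e : V → ℝ} (he : ContDiff ℝ 2 e) {K₂ : ℝ} (hK₂ : ∀ p, ‖iteratedFDeriv ℝ 2 e p‖ ≤ K₂) (p c : V) :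
    |e c - e p - fderiv ℝ e p (c - p)| ≤ K₂ * ‖c - p‖ ^ 2 := by
  -- the segment `g(s) = e(p + s • (c - p))`
  have hg : ContDiff ℝ 2 fun s : ℝ => e (p + s • (c - p)) := contDiff_two_line he p (c - p)
  have h2 : (2 : WithTop ℕ∞) ≠ 0 := by norm_num
  have hgc : ContinuousOn (fun s : ℝ => e (p + s • (c - p))) (Set.Icc 0 1) := hg.continuous.continuousOn
  have hgd : DifferentiableOn ℝ (fun s : ℝ => e (p + s • (c - p))) (Set.Ioo 0 1) := (hg.differentiable h2).differentiableOn
  obtain ⟨ξ, hξ, hslope⟩ := exists_deriv_eq_slope (fun s : ℝ => e (p + s • (c - p))) zero_lt_one hgc hgd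
  simp only [one_smul, zero_smul, add_zero, sub_zero, div_one, add_sub_cancel] at hslope
  rw [deriv_line_eq_fderiv he p (c - p) ξ] at hslope
  -- `|g′(ξ) − g′(0)| ≤ K₂‖c − p‖²·ξ ≤ K₂‖c − p‖²`
  have hdrift := abs_fderiv_line_sub_le he hK₂ p (c - p) ξ
  have hξ1 : |ξ| ≤ 1 := by rw [abs_of_pos hξ.1]; exact hξ.2.le
  have hK0 : 0 ≤ K₂ := le_trans (norm_nonneg _) (hK₂ p)
  have hmono : K₂ * ‖c - p‖ ^ 2 * |ξ| ≤ K₂ * ‖c - p‖ ^ 2 := by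
    have := mul_le_mul_of_nonneg_left hξ1 (by positivity : 0 ≤ K₂ * ‖c - p‖ ^ 2)
    linarith
  rw [hslope] at hdrift
  linarith

/-- **The shell `{|e| ≤ Λ}` is thin across the level set**: if `e(p_F) = 0` and `|e(c)| ≤ Λ` then `|De(p_F)(c − p_F)| ≤ Λ + K₂‖c − p_F‖²`.
[cite: BenfattoGiulianiMastropietro2006, §2.5 (2.46)–(2.50)] -/
theorem abs_fderiv_apply_le_of_level {e : V → ℝ} (he : ContDiff ℝ 2 e) {K₂ : ℝ} (hK₂ : ∀ p, ‖iteratedFDeriv ℝ 2 e p‖ ≤ K₂)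
    {pF c : V} (h0 : e pF = 0) {Λ : ℝ} (hc : |e c| ≤ Λ) : |fderiv ℝ e pF (c - pF)| ≤ Λ + K₂ * ‖c - pF‖ ^ 2 := by
  have h := abs_taylor_two_le he hK₂ pF c
  rw [h0, sub_zero] at h
  have := abs_sub_abs_le_abs_sub (fderiv ℝ e pF (c - pF)) (e c)
  rw [abs_sub_comm] at h
  linarith

end Normed

/-! ### §2 The plane `Fin 2 → ℝ`: gradient pair, unit frame, frame coordinates of a cell point -/

section Plane

/-- **The derivative through the gradient pair**: `De(p)d = d₀·De(p)e₀ + d₁·De(p)e₁`. [folklore] -/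
theorem fderiv_apply_eq_grad (e : (Fin 2 → ℝ) → ℝ) (p d : Fin 2 → ℝ) :
    fderiv ℝ e p d = d 0 * fderiv ℝ e p (Pi.single 0 1) + d 1 * fderiv ℝ e p (Pi.single 1 1) := by
  have hd : d = d 0 • (Pi.single 0 1 : Fin 2 → ℝ) + d 1 • (Pi.single 1 1 : Fin 2 → ℝ) := by
    funext i; fin_cases i <;> simp
  conv_lhs => rw [hd]
  rw [map_add, map_smul, map_smul, smul_eq_mul, smul_eq_mul]

/-- The sup norm on `Fin 2 → ℝ` controls the Euclidean length: `√(d₀² + d₁²) ≤ √2·‖d‖ ≤ 2‖d‖`. [folklore] -/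
theorem sqrt_sq_add_sq_le_two_mul_norm (d : Fin 2 → ℝ) : Real.sqrt (d 0 ^ 2 + d 1 ^ 2) ≤ 2 * ‖d‖ := by
  have h0 : |d 0| ≤ ‖d‖ := by have := norm_le_pi_norm d 0; rwa [Real.norm_eq_abs] at this
  have h1 : |d 1| ≤ ‖d‖ := by have := norm_le_pi_norm d 1; rwa [Real.norm_eq_abs] at this
  have hn : 0 ≤ ‖d‖ := norm_nonneg d
  calc Real.sqrt (d 0 ^ 2 + d 1 ^ 2) ≤ Real.sqrt ((2 * ‖d‖) ^ 2) := by
        refine Real.sqrt_le_sqrt ?_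
        nlinarith [sq_abs (d 0), sq_abs (d 1), abs_nonneg (d 0), abs_nonneg (d 1)]
    _ = 2 * ‖d‖ := Real.sqrt_sq (by positivity)

/-- **Frame coordinates of a cell point.**  Let `g = (De(p_F)e₀, De(p_F)e₁)` with `|g| = √(g₀²+g₁²) ≥ γ > 0`, `n = g/|g|`, `τ = (−n₁, n₀)`.
If `e(p_F) = 0`, `|e(c)| ≤ Λ` and `‖c − p_F‖ ≤ ρ` (sup norm) then `|⟨c − p_F, n⟩| ≤ (Λ + K₂ρ²)/γ` and `|⟨c − p_F, τ⟩| ≤ 2ρ`.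
[cite: BenfattoGiulianiMastropietro2006, §2.5 (2.46)–(2.50)] -/
theorem frame_coords_of_cell {e : (Fin 2 → ℝ) → ℝ} (he : ContDiff ℝ 2 e) {K₂ : ℝ} (hK₂ : ∀ p, ‖iteratedFDeriv ℝ 2 e p‖ ≤ K₂)
    {pF c : Fin 2 → ℝ} (h0 : e pF = 0) {Λ ρ γ : ℝ} (hγ : 0 < γ) (hc : |e c| ≤ Λ) (hρ : ‖c - pF‖ ≤ ρ)
    (hg : γ ≤ Real.sqrt (fderiv ℝ e pF (Pi.single 0 1) ^ 2 + fderiv ℝ e pF (Pi.single 1 1) ^ 2)) :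
    |(c 0 - pF 0) * (fderiv ℝ e pF (Pi.single 0 1) / Real.sqrt (fderiv ℝ e pF (Pi.single 0 1) ^ 2 + fderiv ℝ e pF (Pi.single 1 1) ^ 2)) +
        (c 1 - pF 1) * (fderiv ℝ e pF (Pi.single 1 1) / Real.sqrt (fderiv ℝ e pF (Pi.single 0 1) ^ 2 + fderiv ℝ e pF (Pi.single 1 1) ^ 2))|
        ≤ (Λ + K₂ * ρ ^ 2) / γ ∧
      |(c 0 - pF 0) * (-(fderiv ℝ e pF (Pi.single 1 1) / Real.sqrt (fderiv ℝ e pF (Pi.single 0 1) ^ 2 + fderiv ℝ e pF (Pi.single 1 1) ^ 2))) +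
        (c 1 - pF 1) * (fderiv ℝ e pF (Pi.single 0 1) / Real.sqrt (fderiv ℝ e pF (Pi.single 0 1) ^ 2 + fderiv ℝ e pF (Pi.single 1 1) ^ 2))|
        ≤ 2 * ρ := by
  set g₀ := fderiv ℝ e pF (Pi.single 0 1) with hg₀
  set g₁ := fderiv ℝ e pF (Pi.single 1 1) with hg₁
  set N := Real.sqrt (g₀ ^ 2 + g₁ ^ 2) with hN
  have hNpos : 0 < N := hγ.trans_le hg
  have hNsq : N ^ 2 = g₀ ^ 2 + g₁ ^ 2 := Real.sq_sqrt (by positivity)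
  have hρ0 : 0 ≤ ρ := le_trans (norm_nonneg _) hρ
  have hK0 : 0 ≤ K₂ := le_trans (norm_nonneg _) (hK₂ pF)
  constructor
  · -- normal coordinate: `⟨c − p_F, g⟩ = De(p_F)(c − p_F)`
    have hlin : (c 0 - pF 0) * (g₀ / N) + (c 1 - pF 1) * (g₁ / N) = fderiv ℝ e pF (c - pF) / N := by
      rw [fderiv_apply_eq_grad e pF (c - pF)]
      simp only [Pi.sub_apply, ← hg₀, ← hg₁]
      field_simp
    rw [hlin, abs_div, abs_of_pos hNpos]
    have h1 := abs_fderiv_apply_le_of_level he hK₂ h0 hc (c := c)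
    have h2 : Λ + K₂ * ‖c - pF‖ ^ 2 ≤ Λ + K₂ * ρ ^ 2 := by
      have := pow_le_pow_left₀ (norm_nonneg _) hρ 2
      nlinarith
    calc |fderiv ℝ e pF (c - pF)| / N ≤ (Λ + K₂ * ρ ^ 2) / N := div_le_div_of_nonneg_right (h1.trans h2) hNpos.le
      _ ≤ (Λ + K₂ * ρ ^ 2) / γ := by
          have hΛ0 : 0 ≤ Λ + K₂ * ρ ^ 2 := le_trans (le_trans (abs_nonneg _) h1) h2
          exact div_le_div_of_nonneg_left hΛ0 hγ hg
  · -- tangential coordinate: Cauchy–Schwarz with the unit vector `τ`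
    have hd0 : |c 0 - pF 0| ≤ ρ := by
      have := norm_le_pi_norm (c - pF) 0; rw [Real.norm_eq_abs, Pi.sub_apply] at this; exact this.trans hρ
    have hd1 : |c 1 - pF 1| ≤ ρ := by
      have := norm_le_pi_norm (c - pF) 1; rw [Real.norm_eq_abs, Pi.sub_apply] at this; exact this.trans hρ
    have hn0 : |g₁ / N| ≤ 1 := by
      rw [abs_div, abs_of_pos hNpos, div_le_one hNpos]
      have : g₁ ^ 2 ≤ N ^ 2 := by rw [hNsq]; nlinarith
      exact abs_le_of_sq_le_sq' this hNpos.le |>.2 |> fun h => abs_le.2 ⟨by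
        have := abs_le_of_sq_le_sq' (show g₁ ^ 2 ≤ N ^ 2 by rw [hNsq]; nlinarith) hNpos.le; linarith [this.1], h⟩
    have hn1 : |g₀ / N| ≤ 1 := by
      rw [abs_div, abs_of_pos hNpos, div_le_one hNpos]
      have hh := abs_le_of_sq_le_sq' (show g₀ ^ 2 ≤ N ^ 2 by rw [hNsq]; nlinarith) hNpos.le
      exact abs_le.2 ⟨by linarith [hh.1], hh.2⟩
    calc |(c 0 - pF 0) * (-(g₁ / N)) + (c 1 - pF 1) * (g₀ / N)|
        ≤ |(c 0 - pF 0) * (-(g₁ / N))| + |(c 1 - pF 1) * (g₀ / N)| := abs_add_le _ _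
      _ = |c 0 - pF 0| * |g₁ / N| + |c 1 - pF 1| * |g₀ / N| := by rw [abs_mul, abs_mul, abs_neg]
      _ ≤ ρ * 1 + ρ * 1 := add_le_add (mul_le_mul hd0 hn0 (abs_nonneg _) hρ0) (mul_le_mul hd1 hn1 (abs_nonneg _) hρ0)
      _ = 2 * ρ := by ring

/-- The frame `(n, τ)` built from a nonzero gradient pair is orthonormal. [folklore] -/
theorem frame_orthonormal {g₀ g₁ : ℝ} (hN : 0 < Real.sqrt (g₀ ^ 2 + g₁ ^ 2)) :
    (g₀ / Real.sqrt (g₀ ^ 2 + g₁ ^ 2)) ^ 2 + (g₁ / Real.sqrt (g₀ ^ 2 + g₁ ^ 2)) ^ 2 = 1 ∧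
      (-(g₁ / Real.sqrt (g₀ ^ 2 + g₁ ^ 2))) ^ 2 + (g₀ / Real.sqrt (g₀ ^ 2 + g₁ ^ 2)) ^ 2 = 1 ∧
      g₀ / Real.sqrt (g₀ ^ 2 + g₁ ^ 2) * (-(g₁ / Real.sqrt (g₀ ^ 2 + g₁ ^ 2))) +
        g₁ / Real.sqrt (g₀ ^ 2 + g₁ ^ 2) * (g₀ / Real.sqrt (g₀ ^ 2 + g₁ ^ 2)) = 0 := by
  have hNsq : Real.sqrt (g₀ ^ 2 + g₁ ^ 2) ^ 2 = g₀ ^ 2 + g₁ ^ 2 := Real.sq_sqrt (by positivity)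
  have hN0 : Real.sqrt (g₀ ^ 2 + g₁ ^ 2) ≠ 0 := hN.ne'
  refine ⟨?_, ?_, by ring⟩
  · rw [div_pow, div_pow, ← add_div, hNsq, div_self (by rw [← hNsq]; positivity)]
  · rw [neg_sq, div_pow, div_pow, ← add_div, add_comm, hNsq, div_self (by rw [← hNsq]; positivity)]

end Plane

/-! ### §3 Counting torus momenta in the cell -/

/-- **The torus momenta of a cell `{‖2πk̃/L − p_F‖ ≤ ρ, |e(2πk̃/L)| ≤ Λ}` number at most
`(√2 L (Λ + K₂ρ²)/(γπ) + 2)·(√2 L (2ρ)/π + 2)`** — the rotated box of `frame_coords_of_cell` counted by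
`card_filter_momenta_frameBox_le`. [cite: BenfattoGiulianiMastropietro2006, §2.5 (2.46)–(2.50)] -/
theorem card_filter_cell_le (L : ℕ) [NeZero L] {e : (Fin 2 → ℝ) → ℝ} (he : ContDiff ℝ 2 e) {K₂ : ℝ}
    (hK₂ : ∀ p, ‖iteratedFDeriv ℝ 2 e p‖ ≤ K₂) {pF : Fin 2 → ℝ} (h0 : e pF = 0) {Λ ρ γ : ℝ} (hΛ : 0 ≤ Λ) (hρ : 0 ≤ ρ)
    (hγ : 0 < γ) (hg : γ ≤ Real.sqrt (fderiv ℝ e pF (Pi.single 0 1) ^ 2 + fderiv ℝ e pF (Pi.single 1 1) ^ 2))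
    (S : Finset (TorusSite 2 L))
    (hS : ∀ k ∈ S, |e (fun j => 2 * π * (((k j).valMinAbs : ℤ) : ℝ) / L)| ≤ Λ ∧
      ‖(fun j => 2 * π * (((k j).valMinAbs : ℤ) : ℝ) / L) - pF‖ ≤ ρ) :
    (S.card : ℝ) ≤ (Real.sqrt 2 * L * ((Λ + K₂ * ρ ^ 2) / γ) / π + 2) * (Real.sqrt 2 * L * (2 * ρ) / π + 2) := by
  classical
  set g₀ := fderiv ℝ e pF (Pi.single 0 1) with hg₀
  set g₁ := fderiv ℝ e pF (Pi.single 1 1) with hg₁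
  set N := Real.sqrt (g₀ ^ 2 + g₁ ^ 2) with hN
  have hNpos : 0 < N := hγ.trans_le hg
  obtain ⟨hn, hτ, hnτ⟩ := frame_orthonormal (g₀ := g₀) (g₁ := g₁) hNpos
  have hK0 : 0 ≤ K₂ := le_trans (norm_nonneg _) (hK₂ pF)
  have hB₁ : 0 ≤ (Λ + K₂ * ρ ^ 2) / γ := by positivity
  have hB₂ : 0 ≤ 2 * ρ := by positivity
  have hcount := card_filter_momenta_frameBox_le L (n := ![g₀ / N, g₁ / N]) (τ := ![-(g₁ / N), g₀ / N])
    (by simpa using hn) (by simpa using hτ) (by simpa using hnτ) pF hB₁ hB₂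
  refine le_trans ?_ hcount
  have hsub : S ⊆ (univ : Finset (TorusSite 2 L)).filter fun k =>
      |(2 * π * (((k 0).valMinAbs : ℤ) : ℝ) / L - pF 0) * (![g₀ / N, g₁ / N] 0) +
          (2 * π * (((k 1).valMinAbs : ℤ) : ℝ) / L - pF 1) * (![g₀ / N, g₁ / N] 1)| ≤ (Λ + K₂ * ρ ^ 2) / γ ∧
        |(2 * π * (((k 0).valMinAbs : ℤ) : ℝ) / L - pF 0) * (![-(g₁ / N), g₀ / N] 0) +
          (2 * π * (((k 1).valMinAbs : ℤ) : ℝ) / L - pF 1) * (![-(g₁ / N), g₀ / N] 1)| ≤ 2 * ρ := by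
    intro k hk
    obtain ⟨hke, hkρ⟩ := hS k hk
    obtain ⟨h1, h2⟩ := frame_coords_of_cell he hK₂ h0 hγ hke hkρ hg
    refine Finset.mem_filter.2 ⟨Finset.mem_univ _, ?_, ?_⟩
    · simpa using h1
    · simpa using h2
  exact_mod_cast Finset.card_le_card hsub

end Summit.HubbardSuperconductivity.HubbardSuperconductivity.Theorems.TorusFourierL2

end
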